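import Mathlib
import Summits.Ventures.HodgeRepro.Tier4.Common.KTypeSpace
import Summits.Ventures.HodgeRepro.Tier4.Common.SettingOfData
import Summits.Ventures.HodgeRepro.Tier4.Line4.W4SpectralBridge
import Summits.Ventures.HodgeRepro.Tier4.Line4.AdaptedONBConj

/-!
# Tier4/Line4/KTypeTransport — `R(f)` of a LEFT-`(τ,K)`-equivariant test function lands in the `K`-type space, and
acts by a scalar on a `K`-type space of dimension `≤ 1`

Blind re-derivation cell `pub-hodge-repro`, Tier 4 «prove the step» (README §9–§10), seat t4-L4-p1 (prover, LINE L4,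
gen 3; candidate (i) of S13652).  Tree path `lean/Summits/Ventures/HodgeRepro/Tier4/Line4/KTypeTransport.lean`.
Mathlib-level (a change of variables in the Haar integral); no literature.

WHAT IS PROVED.  For the right-regular action `rightRegular W μ f φ (x) = ∫ f(y) φ(x y) dμ(y)` (typer-2, AdelicRTF) on
typer-2's `Setting.ofAdelicData`:
* `rightRegular_apply_mul_of_left_equivariant`: if `f(κ⁻¹ y) = c · f(y)` for all `y`, then `R(f)φ(x κ) = c · R(f)φ(x)`
  (substitute `y ↦ κ⁻¹ y`, left invariance of the Haar measure);
* `rightRegular_mem_kTypeSpace`: if the test function `f` is LEFT-equivariant under the local tori of `T` and `T′` at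
  every infinite place with the weights `(eP, eM)`, `(eP′, eM′)` and left-invariant under the level `K`, then `R(f)`
  maps every `φ` of an invariant subspace `V` into `kTypeSpace W q g g' eP eM eP' eM' K V` — the `(τ,K)`-projector
  content of the isolation, displayed as the equivariance of `f`;
* `exists_scalar_conj_of_le_span_singleton`: if moreover `kTypeSpace … K V` lies in a line `ℂ ∙ v` (multiplicity one
  of the `(τ,K)`-type on the constituent `V`), then `R(f̄)` acts on the CONJUGATE of the `K`-type space by one scalar:
  `∃ a, ∀ ψ ∈ kTypeSpace … K V, R(f̄)(conj ∘ ψ) = a • conj ∘ ψ` — exactly the clauses `ha` (with `f := f₁`) and `hb`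
  (with `f := cj (refl f₂)`) of `W3OfAdapted.mixed_two_torus_W3_of_adapted`, reduced to multiplicity one + the
  displayed left-equivariance of the test functions.  What is NOT here: `hvan` (the vanishing on the orthogonal
  complement of the `K`-type space needs the projector identity, i.e. harmonic analysis on the compact tori) and
  multiplicity one itself (print-facing: Ichino Lemma 7.8 at `w₀`, the newform level at the finite places).

Nothing here says anything about the status of the Hodge conjecture for CM abelian varieties, which is NOT proved
(HC_CM is NOT proved by anyone in this repository).
-/

set_option autoImplicit false

noncomputable section

namespace Summit.Ventures.HodgeRepro.Tier4.Line4

open Summit.Ventures.HodgeRepro.Tier4.Common Summit.Ventures.HodgeRepro.Tier4.Line1 MeasureTheory NumberField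
open scoped ComplexConjugate

section Transport

variable {k : Type} [Field k] [NumberField k] (W : PlaneData k) [MeasurableSpace (GA W)] [BorelSpace (GA W)]
  (μ : Measure (GA W)) [μ.IsHaarMeasure]

omit [BorelSpace (GA W)] [μ.IsHaarMeasure] in
/-- `R(f)` is homogeneous in the function. -/
theorem rightRegular_const_mul (f ψ : GA W → ℂ) (c : ℂ) :
    rightRegular W μ f (fun x => c * ψ x) = fun x => c * rightRegular W μ f ψ x := by
  funext x
  simp only [rightRegular]
  rw [← integral_const_mul]
  congr 1
  funext y
  ring

omit [BorelSpace (GA W)] [μ.IsHaarMeasure] in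
/-- `R(f) 0 = 0`. -/
theorem rightRegular_zero (f : GA W → ℂ) : rightRegular W μ f (fun _ => 0) = fun _ => 0 := by
  funext x
  simp [rightRegular]

/-- **Left equivariance transports**: `f(κ⁻¹ y) = c · f(y)` for all `y` gives `R(f)φ(x κ) = c · R(f)φ(x)`. -/
theorem rightRegular_apply_mul_of_left_equivariant (f φ : GA W → ℂ) (x κ : GA W) (c : ℂ)
    (hf : ∀ y, f (κ⁻¹ * y) = c * f y) :
    rightRegular W μ f φ (x * κ) = c * rightRegular W μ f φ x := by
  simp only [rightRegular]
  rw [← integral_mul_left_eq_self (fun y => f y * φ (x * κ * y)) κ⁻¹, ← integral_const_mul]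
  congr 1
  funext y
  rw [hf y, mul_assoc x κ, mul_inv_cancel_left, mul_assoc]

omit [MeasurableSpace (GA W)] [BorelSpace (GA W)] [μ.IsHaarMeasure] in
/-- `RTF.cj` is an involution. -/
theorem cj_cj (f : GA W → ℂ) : RTF.cj (RTF.cj f) = f := by
  funext y
  simp [RTF.cj]

variable (R : RTFData W) [R.μT.IsHaarMeasure] [R.μT'.IsHaarMeasure]
  (DG : Set (GA W)) (fdG : IsFundamentalDomain (rationalPoints W) DG μ) (compG : IsCompact (closure DG))
  (compT : IsCompact (closure R.DT)) (compT' : IsCompact (closure R.DT'))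

/-- **`R(f)` of a left-`(τ,K)`-equivariant test function lands in the `K`-type space**: for `f` left-equivariant
under the local tori of `T` and `T′` at every infinite place with the weights `(eP, eM)`, `(eP′, eM′)` and
left-invariant under `K`, and `φ` in an invariant subspace `V`, `R(f)φ ∈ kTypeSpace W q g g' eP eM eP' eM' K V`. -/
theorem rightRegular_mem_kTypeSpace (q : QuadData k) (g g' : Matrix (Fin 4) (Fin 4) k)
    (eP eM eP' eM' : InfinitePlace k → ℤ) (K : Subgroup (GA W)) (V : Submodule ℂ (GA W → ℂ))
    (hV : (Setting.ofAdelicData W R μ DG fdG compG compT compT').IsInvariantSubspace (V : Set (GA W → ℂ)))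
    {f : GA W → ℂ} (hf : IsTestFn W f)
    (hfT : ∀ (w : InfinitePlace k) (κ : GA W), κ ∈ localTorusAt W w → ∀ y,
      f (κ⁻¹ * y) = weightAt W q w 0 κ ^ eP w * weightAt W q w 1 κ ^ eM w * f y)
    (hfT' : ∀ (w : InfinitePlace k) (κ : GA W), κ ∈ localTorusAt' W w → ∀ y,
      f (κ⁻¹ * y) = weightAt' W q w g g' 0 κ ^ eP' w * weightAt' W q w g g' 1 κ ^ eM' w * f y)
    (hfK : ∀ κ ∈ K, ∀ y, f (κ⁻¹ * y) = f y)
    {φ : GA W → ℂ} (hφ : φ ∈ V) :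
    rightRegular W μ f φ ∈ kTypeSpace W q g g' eP eM eP' eM' K V := by
  refine ⟨hV.conv φ hφ f ⟨hf.1, hf.2⟩, fun w x κ hκ => ?_, fun w x κ hκ => ?_, fun x κ hκ => ?_⟩
  · exact rightRegular_apply_mul_of_left_equivariant W μ f φ x κ _ (hfT w κ hκ)
  · exact rightRegular_apply_mul_of_left_equivariant W μ f φ x κ _ (hfT' w κ hκ)
  · have := rightRegular_apply_mul_of_left_equivariant W μ f φ x κ 1 (fun y => by rw [hfK κ hκ y, one_mul])
    rw [this, one_mul]

/-- **One scalar on a one-dimensional `K`-type space, on the conjugates**: if `f` is a left-`(τ,K)`-equivariant test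
function and `kTypeSpace … K V` lies in a line `ℂ ∙ v` (multiplicity one of the `(τ,K)`-type on `V`), then
`R(f̄)` acts on the conjugates of the `K`-type vectors by one scalar — the clause `ha` / `hb` of
`mixed_two_torus_W3_of_adapted` for the constituent `V` (with `f := f₁`, resp. `f := cj (refl f₂)`). -/
theorem exists_scalar_conj_of_le_span_singleton (q : QuadData k) (g g' : Matrix (Fin 4) (Fin 4) k)
    (eP eM eP' eM' : InfinitePlace k → ℤ) (K : Subgroup (GA W)) (V : Submodule ℂ (GA W → ℂ))
    (hV : (Setting.ofAdelicData W R μ DG fdG compG compT compT').IsInvariantSubspace (V : Set (GA W → ℂ)))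
    {f : GA W → ℂ} (hf : IsTestFn W f)
    (hfT : ∀ (w : InfinitePlace k) (κ : GA W), κ ∈ localTorusAt W w → ∀ y,
      f (κ⁻¹ * y) = weightAt W q w 0 κ ^ eP w * weightAt W q w 1 κ ^ eM w * f y)
    (hfT' : ∀ (w : InfinitePlace k) (κ : GA W), κ ∈ localTorusAt' W w → ∀ y,
      f (κ⁻¹ * y) = weightAt' W q w g g' 0 κ ^ eP' w * weightAt' W q w g g' 1 κ ^ eM' w * f y)
    (hfK : ∀ κ ∈ K, ∀ y, f (κ⁻¹ * y) = f y)
    (hmult : ∃ v : GA W → ℂ, kTypeSpace W q g g' eP eM eP' eM' K V ≤ Submodule.span ℂ {v}) :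
    ∃ a : ℂ, ∀ ψ ∈ kTypeSpace W q g g' eP eM eP' eM' K V,
      rightRegular W μ (RTF.cj f) (fun x => conj (ψ x)) = fun x => a * conj (ψ x) := by
  classical
  set S := Setting.ofAdelicData W R μ DG fdG compG compT compT' with hS
  set Wk := kTypeSpace W q g g' eP eM eP' eM' K V with hWk
  -- `R(f̄)(conj ∘ ψ) = conj ∘ R(f) ψ`
  have hconj : ∀ ψ : GA W → ℂ, rightRegular W μ (RTF.cj f) (fun x => conj (ψ x)) =
      fun x => conj (rightRegular W μ f ψ x) := by
    intro ψ
    have h := R_conj S (RTF.cj f) ψ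
    rw [cj_cj] at h
    exact h
  -- `R(f)` acts on `Wk` by a scalar
  have hscalar : ∃ a : ℂ, ∀ ψ ∈ Wk, rightRegular W μ f ψ = fun x => a * ψ x := by
    obtain ⟨v, hv⟩ := hmult
    by_cases hbot : ∃ w ∈ Wk, w ≠ 0
    · obtain ⟨w, hw, hwne⟩ := hbot
      obtain ⟨c, hc⟩ := Submodule.mem_span_singleton.1 (hv hw)
      have hcne : c ≠ 0 := by
        rintro rfl
        apply hwne
        rw [← hc, zero_smul]
      -- `v = c⁻¹ • w ∈ Wk ⊆ V`
      have hvWk : v ∈ Wk := by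
        have : v = c⁻¹ • w := by
          rw [← hc, smul_smul, inv_mul_cancel₀ hcne, one_smul]
        rw [this]
        exact Wk.smul_mem _ hw
      have hvV : v ∈ V := kTypeSpace_le W q g g' eP eM eP' eM' K V hvWk
      have hRv : rightRegular W μ f v ∈ Submodule.span ℂ {v} :=
        hv (rightRegular_mem_kTypeSpace W μ R DG fdG compG compT compT' q g g' eP eM eP' eM' K V hV hf hfT hfT'
          hfK hvV)
      obtain ⟨a, ha⟩ := Submodule.mem_span_singleton.1 hRv
      refine ⟨a, fun ψ hψ => ?_⟩
      obtain ⟨d, hd⟩ := Submodule.mem_span_singleton.1 (hv hψ)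
      have e1 : ψ = fun x => d * v x := by
        rw [← hd]
        rfl
      rw [e1, rightRegular_const_mul, ← ha]
      funext x
      simp only [Pi.smul_apply, smul_eq_mul]
      ring
    · have hbot' : ∀ ψ ∈ Wk, ψ = 0 := fun ψ hψ => by
        by_contra h
        exact hbot ⟨ψ, hψ, h⟩
      refine ⟨0, fun ψ hψ => ?_⟩
      rw [hbot' ψ hψ]
      have e : (0 : GA W → ℂ) = fun _ => 0 := rfl
      rw [e, rightRegular_zero]
      funext x
      simp
  obtain ⟨a, ha⟩ := hscalar
  refine ⟨conj a, fun ψ hψ => ?_⟩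
  rw [hconj, ha ψ hψ]
  funext x
  simp only [map_mul]

end Transport

end Summit.Ventures.HodgeRepro.Tier4.Line4

end
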